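import Summits.RiemannHypothesis.RiemannHypothesis.Theorems.WeilTwoPrimeDeflM78FBase
import Summits.RiemannHypothesis.RiemannHypothesis.Theorems.WeilTwoPrimeDeflM78FDataPO25
import Literature.NumberTheory.LFunctions.WeilBlockRowsPZ
import Literature.NumberTheory.LFunctions.WeilBlockRowsFast
import Literature.NumberTheory.LFunctions.WeilTwoPrimeOddMarginHDataDn12
import HarnessLib

/-!
# Deflated two-prime certificate M78F: dominance of rows 106–107 of `R = S''_odd(κ') − UᵀU` (factored data)

`WeilCert.checkDomRowPZ` with the materialized augmented block, the factored inverse `weilCert23HDn/weilCert23HLs` and the Bessel block, by `decide +kernel` row by row. Pure proof file.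
-/

noncomputable section

set_option linter.dupNamespace false

namespace Summit.RiemannHypothesis.RiemannHypothesis.Theorems.EvenWinsBeyondArch

open Literature.NumberTheory.LFunctions

set_option maxHeartbeats 0 in
/-- Kernel check of the dominance of row 106 of `R` (odd block, certificate M78F). [folklore] -/
theorem checkDomRowF1_106_weilCertDeflM78F :
    weilCertDeflM78FBase.checkDomRowF weilCertDeflM78FPmO weilCert23HDn weilCert23HLs weilCertDeflM78FHpO weilCertDeflM78FKappa' 1 106 = true := by
  decide +kernel

/-- Kernel check of the dominance of row 106 of `R` (factored data), from the fast row. [folklore] -/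
theorem checkDomRowPZ1_106_weilCertDeflM78F :
    weilCertDeflM78FBase.checkDomRowPZ weilCertDeflM78FPmO weilCert23HDn weilCert23HLs weilCertDeflM78FHpO weilCertDeflM78FKappa' 1 106 = true :=
  WeilCert.checkDomRowPZ_of_F (by decide) checkDomRowF1_106_weilCertDeflM78F

set_option maxHeartbeats 0 in
/-- Kernel check of the dominance of row 107 of `R` (odd block, certificate M78F). [folklore] -/
theorem checkDomRowF1_107_weilCertDeflM78F :
    weilCertDeflM78FBase.checkDomRowF weilCertDeflM78FPmO weilCert23HDn weilCert23HLs weilCertDeflM78FHpO weilCertDeflM78FKappa' 1 107 = true := by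
  decide +kernel

/-- Kernel check of the dominance of row 107 of `R` (factored data), from the fast row. [folklore] -/
theorem checkDomRowPZ1_107_weilCertDeflM78F :
    weilCertDeflM78FBase.checkDomRowPZ weilCertDeflM78FPmO weilCert23HDn weilCert23HLs weilCertDeflM78FHpO weilCertDeflM78FKappa' 1 107 = true :=
  WeilCert.checkDomRowPZ_of_F (by decide) checkDomRowF1_107_weilCertDeflM78F


end Summit.RiemannHypothesis.RiemannHypothesis.Theorems.EvenWinsBeyondArch
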